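import Mathlib
import HarnessLib
import Summits.HubbardSuperconductivity.HubbardSuperconductivity.Theorems.KLProgrammeKLRegimeTwoVolumeTowerRatiosOfLaws

/-!
# Route `KLProgramme` — crux K3, VL child `KLRegimeVolumeLimitV17F2` (stmt-HubbardSuperconductivity-20440), skeleton «cauchy» v11: (H1)–(H3) OF `TowerDataTS`
# FROM THE SCALE LAWS AND ONE SMALLNESS INEQUALITY PER SCALE (assembler kit; seat hubbard-kl-k3c4-p1 g15; `--supports` 20440)

`…TowerSmallnessGeom.towerSmallness_of_geom` (p615797) turns per-scale radii, ratios, majorants and five smallness lines into the fields (H2)–(H3) of the data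
package.  With the radii of `…TowerRatiosOfLaws` (all `= κ_j` except `ρ₀_j = r₀·κ_j`, `q_j = 1/(2(e²(κ_j+ρ₀_j))²)`), every ratio is `≤ 1/2`, so every majorant is an explicit multiple of the profile constant `A_j` (`…TowerBudgetGeom`) or of the previous scale's next raw budget
`Db_{j−1} ≤ 4e·A_{j−1}`, and the five smallness lines follow from ONE scalar inequality per scale,
`e·(aW_j + cRb_j + cCb_j + 1)·(42·cW_j + 4·δb_j + 8e)·max(A_j, 4e·A_{j−1}) ≤ κ_j²/2`
(`A_j = O(ε_{j+1}·32^{−j})`, `aW_j/κ_j² ≍ 32^j` ⇒ a `U ≤ U₀`, `c ≤ c₀` condition — the assembler's last step).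

* **`towerSmallness_of_laws`** — `∃ ρ₀ NS ν₀ … ν₈` with `0 < ρ₀`, (H2) and `TowerScaleSmall …` at every `j < J`, radii `ρf = ρ₂ = ρ′ = ρ₃ := κ`, `κ′ := κ`, `aW′ := aW`.

Proofs only; no definition; elementary. [cite: BenfattoGiulianiMastropietro2006, §2.7 (2.77)-(2.80), §3 (3.2)-(3.8)]
-/

noncomputable section

namespace Summit.HubbardSuperconductivity.HubbardSuperconductivity.Theorems.TwoVolumeSource

set_option linter.dupNamespace false -- summit = problem name (single-conjunct summit), D-0017

/-! ## §1 Scalar lemmas -/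

/-- `a/(1−x) ≤ 2a` for `0 ≤ a`, `x ≤ 1/2`. [folklore] -/
private theorem div_one_sub_le_two_mul {a x : ℝ} (ha : 0 ≤ a) (hx : x ≤ 1 / 2) : a / (1 - x) ≤ 2 * a := by
  have h1 : 1 / 2 ≤ 1 - x := by linarith
  calc a / (1 - x) ≤ a / (1 / 2) := div_le_div_of_nonneg_left ha (by norm_num) h1
    _ = 2 * a := by ring

/-- `x/(1−x)² ≤ 2` for `x ≤ 1/2`. [folklore] -/
private theorem div_sq_one_sub_le_two {x : ℝ} (hx : x ≤ 1 / 2) : x / (1 - x) ^ 2 ≤ 2 := by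
  have h1 : 1 / 4 ≤ (1 - x) ^ 2 := by nlinarith
  calc x / (1 - x) ^ 2 ≤ (1 / 2) / (1 - x) ^ 2 := div_le_div_of_nonneg_right hx (by positivity)
    _ ≤ (1 / 2) / (1 / 4) := div_le_div_of_nonneg_left (by norm_num) (by norm_num) h1
    _ = 2 := by norm_num

/-- `0 ≤ a/(1−x)` for `0 ≤ a`, `x < 1`. [folklore] -/
private theorem div_one_sub_nonneg {a x : ℝ} (ha : 0 ≤ a) (hx : x < 1) : 0 ≤ a / (1 - x) := div_nonneg ha (by linarith)

/-- Scale `0` pattern, quantitative: `(E·S)²·(c²·q) ≤ 1/2`. [folklore] -/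
private theorem ratio_le_half_zero {E κ S c s c₀ r : ℝ} (hE : 0 < E) (hκ : 0 < κ) (hS0 : 0 ≤ S) (hS : S ≤ s * κ) (hc0 : 0 ≤ c) (hc : c ≤ c₀)
    (hs : 0 ≤ s) (hr : 0 ≤ r) (hsc : s * c₀ ≤ 1 + r) :
    (E * S) ^ 2 * (c ^ 2 * (1 / (2 * (E * (κ + r * κ)) ^ 2))) ≤ 1 / 2 := by
  have hD : 0 < E * (κ + r * κ) := by positivity
  have h1 : E * S * c ≤ E * (κ + r * κ) := by
    have h2 : S * c ≤ s * κ * c₀ := mul_le_mul hS hc hc0 (by positivity)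
    have h3 : s * κ * c₀ ≤ (1 + r) * κ := by nlinarith [hκ.le]
    nlinarith [hE.le]
  have h0 : 0 ≤ E * S * c := by positivity
  have h4 : (E * S * c) ^ 2 ≤ (E * (κ + r * κ)) ^ 2 := pow_le_pow_left₀ h0 h1 2
  have hD2 : 0 < (E * (κ + r * κ)) ^ 2 := by positivity
  calc (E * S) ^ 2 * (c ^ 2 * (1 / (2 * (E * (κ + r * κ)) ^ 2))) = (E * S * c) ^ 2 / (2 * (E * (κ + r * κ)) ^ 2) := by ring
    _ ≤ (E * (κ + r * κ)) ^ 2 / (2 * (E * (κ + r * κ)) ^ 2) := div_le_div_of_nonneg_right h4 (by positivity)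
    _ = 1 / 2 := by field_simp

/-- Scale `i+1` pattern, quantitative: `(E·S)²·(c²·(r·κ)⁻²) ≤ 1/4` when `2·E·s·c₀ ≤ r`. [folklore] -/
private theorem ratio_le_succ {E κ S c s c₀ r : ℝ} (hE : 0 < E) (hκ : 0 < κ) (hS0 : 0 ≤ S) (hS : S ≤ s * κ) (hc0 : 0 ≤ c) (hc : c ≤ c₀)
    (hs : 0 ≤ s) (hr : 0 < r) (hsc : 2 * (E * s * c₀) ≤ r) :
    (E * S) ^ 2 * (c ^ 2 * (r * κ)⁻¹ ^ 2) ≤ 1 / 4 := by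
  have h1 : 2 * (E * S * c) ≤ r * κ := by
    have h2 : S * c ≤ s * κ * c₀ := mul_le_mul hS hc hc0 (by positivity)
    have h3 : 2 * (E * (s * κ * c₀)) ≤ r * κ := by nlinarith [hκ.le]
    nlinarith [hE.le]
  have h0 : 0 ≤ E * S * c := by positivity
  have h4 : (2 * (E * S * c)) ^ 2 ≤ (r * κ) ^ 2 := pow_le_pow_left₀ (by positivity) h1 2
  have hD2 : 0 < (r * κ) ^ 2 := by positivity
  calc (E * S) ^ 2 * (c ^ 2 * (r * κ)⁻¹ ^ 2) = (2 * (E * S * c)) ^ 2 / (r * κ) ^ 2 / 4 := by rw [inv_pow]; ring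
    _ ≤ (r * κ) ^ 2 / (r * κ) ^ 2 / 4 := by gcongr
    _ = 1 / 4 := by rw [div_self hD2.ne']

/-! ## §2 (H1)–(H3) from the laws -/

set_option maxHeartbeats 1600000 in -- one ~40-argument instantiation of `towerSmallness_of_geom` plus the per-scale bookkeeping
/-- **(H1)–(H3) OF `TowerDataTS` FROM THE SCALE LAWS AND ONE SMALLNESS INEQUALITY PER SCALE** (see the module docstring).  Inputs per scale `j`:
the Gram constant `κ_j` (both volumes; `κ_{j+1} ≤ κ_j`), the frame-path Gram constant `κ_j ≤ κf_j ≤ kf·κ_j`, the weighted-row constant `aW_j ≥ 0` (both volumes),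
the transfer constant `1 ≤ cW_j ≤ cW₀`, the mismatch caps `cRb_j, cCb_j ≥ 0`, `0 ≤ δb_j ≤ δb₀`, the profile budgets `NV j m ≤ A_j·q_j^m` at
`q_j = 1/(2(e²(κ_j + r₀κ_j))²)`, `r₀ ≥ 8e²(kf+1)(cW₀+δb₀+1)`, and the two smallness inequalities (own scale / previous scale).
Output: the radius `ρ₀ = r₀·κ`, the raw budgets `NS` and the series `ν₀ … ν₈` with (H2) and `TowerScaleSmall` at every `j < J` (radii `ρf = ρ₂ = ρ′ = ρ₃ := κ`).
[cite: BenfattoGiulianiMastropietro2006, §2.7 (2.77)-(2.80), §3 (3.2)-(3.8)] -/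
theorem towerSmallness_of_laws (J : ℕ) (κ κf aW cW cRb cCb δb A q : ℕ → ℝ) (NV : ℕ → ℕ → ℝ) (kf cW₀ δb₀ r₀ : ℝ)
    (hκ : ∀ j, 0 < κ j) (hκmono : ∀ j, κ (j + 1) ≤ κ j) (hκfge : ∀ j, κ j ≤ κf j) (hκf : ∀ j, κf j ≤ kf * κ j) (hkf : 1 ≤ kf)
    (haW : ∀ j, 0 ≤ aW j) (hcW1 : ∀ j, 1 ≤ cW j) (hcW : ∀ j, cW j ≤ cW₀) (hcRb : ∀ j, 0 ≤ cRb j) (hcCb : ∀ j, 0 ≤ cCb j)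
    (hδb0 : ∀ j, 0 ≤ δb j) (hδb : ∀ j, δb j ≤ δb₀) (hr₀ : 8 * Real.exp 2 * (kf + 1) * (cW₀ + δb₀ + 1) ≤ r₀)
    (hq : ∀ j, q j = 1 / (2 * (Real.exp 2 * (κ j + r₀ * κ j)) ^ 2))
    (hNV0 : ∀ j m, 0 ≤ NV j m) (hA0 : ∀ j, 0 ≤ A j) (hNV : ∀ j m, NV j m ≤ A j * q j ^ m)
    (hS : ∀ j, j < J → Real.exp 1 * (aW j + cRb j + cCb j + 1) * (42 * cW j + 4 * δb j + 8 * Real.exp 1) * A j ≤ κ j ^ 2 / 2)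
    (hS' : ∀ j, j + 1 < J →
      Real.exp 1 * (aW (j + 1) + cRb (j + 1) + cCb (j + 1) + 1) * (42 * cW (j + 1) + 4 * δb (j + 1) + 8 * Real.exp 1) * (4 * Real.exp 1 * A j) ≤ κ (j + 1) ^ 2 / 2) :
    ∃ (ρ₀ : ℕ → ℝ) (NS : ℕ → ℕ → ℝ) (ν₀ ν₁ ν₂ ν₃ ν₄ ν₅ νE ν₆ ν₇ ν₈ : ℕ → ℝ),
      (∀ j, 0 < ρ₀ j) ∧ (∀ j k, 0 ≤ NS j k) ∧ (∀ k, NS 0 k = if Even k then NV 0 (k / 2) else 0) ∧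
      (∀ j k, j < J → NS (j + 1) k = (ρ₀ j)⁻¹ ^ k * (Real.exp 1 * ν₀ j) / (1 - Real.exp 1 * aW j * ν₀ j / κ j ^ 2)) ∧
      (∀ j, j < J → TowerScaleSmall (κ j) (κ j) (aW j) (aW j) (cW j) (κf j) (cRb j) (cCb j) (δb j) (ρ₀ j) (κ j) (κ j) (κ j) (κ j)
        (NV j) (NS j) (ν₀ j) (ν₁ j) (ν₂ j) (ν₃ j) (ν₄ j) (ν₅ j) (νE j) (ν₆ j) (ν₇ j) (ν₈ j)) := by
  classical
  -- §0 sizes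
  have hE : 0 < Real.exp 2 := Real.exp_pos 2
  have hE1 : 1 ≤ Real.exp 2 := Real.one_le_exp (by norm_num)
  have he : 0 < Real.exp 1 := Real.exp_pos 1
  have he1 : 1 ≤ Real.exp 1 := Real.one_le_exp (by norm_num)
  have hcW₀ : 1 ≤ cW₀ := (hcW1 0).trans (hcW 0)
  have hδb₀ : 0 ≤ δb₀ := (hδb0 0).trans (hδb 0)
  have hκf0 : ∀ j, 0 < κf j := fun j => (hκ j).trans_le (hκfge j)
  -- consequences of the size of `r₀`: `P := (kf+1)(cW₀+δb₀+1)`, `8·E·P ≤ r₀`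
  have hP1 : 1 ≤ (kf + 1) * (cW₀ + δb₀ + 1) := by nlinarith
  have hPa : 2 * cW₀ ≤ (kf + 1) * (cW₀ + δb₀ + 1) := by nlinarith
  have hPb : (kf + 1) * (cW₀ + δb₀) ≤ (kf + 1) * (cW₀ + δb₀ + 1) := by nlinarith
  have hP7 : (7 : ℝ) ≤ 2 * ((kf + 1) * (cW₀ + δb₀ + 1)) := by nlinarith
  have h8E : 0 ≤ 8 * Real.exp 2 := by positivity
  have hr₀' : 8 * Real.exp 2 * ((kf + 1) * (cW₀ + δb₀ + 1)) ≤ r₀ := by rw [← mul_assoc]; exact hr₀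
  have hr₀E : 8 * Real.exp 2 ≤ r₀ := (le_mul_of_one_le_right h8E hP1).trans hr₀'
  have hr₀pos : 0 < r₀ := by linarith
  have hr₀1 : 1 ≤ r₀ := by linarith
  have hr₀P : (kf + 1) * (cW₀ + δb₀ + 1) ≤ r₀ :=
    le_trans (le_mul_of_one_le_left (by positivity) (by linarith)) hr₀'
  have hc5 : 2 * (Real.exp 2 * (kf + 1) * (cW₀ + δb₀)) ≤ r₀ := by
    have h := mul_le_mul_of_nonneg_left hPb h8E
    nlinarith [h, hr₀', hE.le, mul_nonneg hE.le (le_trans zero_le_one hP1)]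
  have hc3 : 2 * (Real.exp 2 * 2 * cW₀) ≤ r₀ := by
    have h := mul_le_mul_of_nonneg_left hPa h8E
    nlinarith [h, hr₀', hE.le, mul_nonneg hE.le (le_trans zero_le_one hP1)]
  have hc7 : 2 * (Real.exp 2 * 7 * 1) ≤ r₀ := by
    have h := mul_le_mul_of_nonneg_left hP7 hE.le
    nlinarith [h, hr₀']
  have hc6 : 2 * (Real.exp 2 * 3 * 1) ≤ r₀ := by linarith [hc7, hE.le]
  have hc4 : (kf + 1) * (cW₀ + δb₀) ≤ 1 + r₀ := by linarith [hPb, hr₀P]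
  have hc2 : 2 * cW₀ ≤ 1 + r₀ := by linarith [hPa, hr₀P]
  -- §1 the choice: `ρ₀ = r₀ κ`, `τ 0 = q 0`, `τ (j+1) = ρ₀ j ⁻²`
  obtain ⟨ρ₀, hρ₀⟩ : ∃ ρ₀ : ℕ → ℝ, ∀ j, ρ₀ j = r₀ * κ j := ⟨_, fun _ => rfl⟩
  obtain ⟨τ, hτ⟩ : ∃ τ : ℕ → ℝ, ∀ j, τ j = if j = 0 then q 0 else (ρ₀ (j - 1))⁻¹ ^ 2 := ⟨_, fun _ => rfl⟩
  have hτ0 : τ 0 = q 0 := by rw [hτ]; simp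
  have hτs : ∀ j, τ (j + 1) = (ρ₀ j)⁻¹ ^ 2 := fun j => by rw [hτ]; simp
  have hq' : ∀ j, q j = 1 / (2 * (Real.exp 2 * (κ j + ρ₀ j)) ^ 2) := fun j => by rw [hq, hρ₀]
  -- §2 the ratios (`< 1` forms, for the generic theorem)
  obtain ⟨hρ₀pos, hq0, hτnn, hτ0le, hτsucc, hr₀', hr₅', hr₄', hr₁', hx₁', hy₆'⟩ :=
    towerRatios_of_laws J κ κ κf cW δb ρ₀ q τ kf cW₀ δb₀ r₀ hκ hκ (fun j => le_rfl) hκmono hκf0 hκf hkf hcW1 hcW hδb0 hδb hr₀ hρ₀ hq' hτ0 hτs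
  -- quantitative ratios (`≤ 1/2`)
  have hqid : ∀ j, (Real.exp 2 * (κ j + ρ₀ j)) ^ 2 * q j = 1 / 2 := fun j => by
    have hne : κ j + ρ₀ j ≠ 0 := by have := hκ j; have := hρ₀pos j; positivity
    rw [hq' j]; field_simp
  have hR1 : ∀ j, (Real.exp 2 * (κ j + κ j)) ^ 2 * q j ≤ 1 / 2 := fun j => by
    have hS : Real.exp 2 * (κ j + κ j) ≤ Real.exp 2 * (κ j + ρ₀ j) := by
      refine mul_le_mul_of_nonneg_left ?_ hE.le
      have : κ j ≤ r₀ * κ j := le_mul_of_one_le_left (hκ j).le hr₀1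
      rw [hρ₀]; linarith
    have hS0 : 0 ≤ Real.exp 2 * (κ j + κ j) := by have := hκ j; positivity
    calc (Real.exp 2 * (κ j + κ j)) ^ 2 * q j ≤ (Real.exp 2 * (κ j + ρ₀ j)) ^ 2 * q j :=
          mul_le_mul_of_nonneg_right (pow_le_pow_left₀ hS0 hS 2) (hq0 j)
      _ = 1 / 2 := hqid j
  have hX1 : ∀ j, (Real.exp 2 * (κ j + κ j)) ^ 2 * (cW j ^ 2 * τ j) ≤ 1 / 2 := fun j => by
    cases j with
    | zero =>
      rw [hτ0, hq 0]
      exact ratio_le_half_zero (S := κ 0 + κ 0) (s := 2) hE (hκ 0) (by have := hκ 0; positivity) (by linarith) (zero_le_one.trans (hcW1 0)) (hcW 0)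
        (by norm_num) hr₀pos.le hc2
    | succ i =>
      rw [hτs i, hρ₀ i]
      exact (ratio_le_succ (S := κ (i + 1) + κ (i + 1)) (s := 2) hE (hκ i) (by have := hκ (i + 1); positivity) (by linarith [hκmono i])
        (zero_le_one.trans (hcW1 (i + 1))) (hcW (i + 1)) (by norm_num) hr₀pos hc3).trans (by norm_num)
  have hY7 : ∀ j, (Real.exp 2 * (κf j + κ j)) ^ 2 * (cW j ^ 2 * τ j) ≤ 1 / 2 := fun j => by
    have hSj : κf j + κ j ≤ (kf + 1) * κ j := by nlinarith [hκf j, hκ j]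
    have hcd : cW j ≤ cW₀ + δb₀ := (hcW j).trans (le_add_of_nonneg_right hδb₀)
    cases j with
    | zero =>
      rw [hτ0, hq 0]
      exact ratio_le_half_zero (S := κf 0 + κ 0) (s := kf + 1) hE (hκ 0) (by have := hκf0 0; have := hκ 0; positivity) hSj (zero_le_one.trans (hcW1 0)) hcd
        (by linarith) hr₀pos.le hc4
    | succ i =>
      rw [hτs i, hρ₀ i]
      exact (ratio_le_succ (S := κf (i + 1) + κ (i + 1)) (s := kf + 1) hE (hκ i) (by have := hκf0 (i + 1); have := hκ (i + 1); positivity)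
        (hSj.trans (mul_le_mul_of_nonneg_left (hκmono i) (by linarith))) (zero_le_one.trans (hcW1 (i + 1))) hcd (by linarith) hr₀pos hc5).trans
        (by norm_num)
  have hY6 : ∀ j, (Real.exp 2 * (κf j + κ j)) ^ 2 * ((cW j + δb j) ^ 2 * τ j) ≤ 1 / 2 := fun j => by
    have hSj : κf j + κ j ≤ (kf + 1) * κ j := by nlinarith [hκf j, hκ j]
    have hcd0 : 0 ≤ cW j + δb j := add_nonneg (zero_le_one.trans (hcW1 j)) (hδb0 j)
    have hcd : cW j + δb j ≤ cW₀ + δb₀ := add_le_add (hcW j) (hδb j)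
    cases j with
    | zero =>
      rw [hτ0, hq 0]
      exact ratio_le_half_zero (S := κf 0 + κ 0) (s := kf + 1) hE (hκ 0) (by have := hκf0 0; have := hκ 0; positivity) hSj hcd0 hcd (by linarith)
        hr₀pos.le hc4
    | succ i =>
      rw [hτs i, hρ₀ i]
      exact (ratio_le_succ (S := κf (i + 1) + κ (i + 1)) (s := kf + 1) hE (hκ i) (by have := hκf0 (i + 1); have := hκ (i + 1); positivity)
        (hSj.trans (mul_le_mul_of_nonneg_left (hκmono i) (by linarith))) hcd0 hcd (by linarith) hr₀pos hc5).trans (by norm_num)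
  have hR5 : ∀ j, (Real.exp 2 * (κ j + κ j + κ j)) ^ 2 * (ρ₀ j)⁻¹ ^ 2 ≤ 1 / 2 := fun j => by
    have h := ratio_le_succ (S := κ j + κ j + κ j) (c := 1) (c₀ := 1) (s := 3) hE (hκ j) (by have := hκ j; positivity) (by linarith) zero_le_one le_rfl
      (by norm_num) hr₀pos hc6
    rw [hρ₀ j, show (Real.exp 2 * (κ j + κ j + κ j)) ^ 2 * (r₀ * κ j)⁻¹ ^ 2 = (Real.exp 2 * (κ j + κ j + κ j)) ^ 2 * (1 ^ 2 * (r₀ * κ j)⁻¹ ^ 2) by ring]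
    exact h.trans (by norm_num)
  have hR4 : ∀ j, (Real.exp 2 * (κ j + κ j + (κ j + κ j + (κ j + κ j)) + κ j)) ^ 2 * (ρ₀ j)⁻¹ ^ 2 ≤ 1 / 2 := fun j => by
    have h := ratio_le_succ (S := κ j + κ j + (κ j + κ j + (κ j + κ j)) + κ j) (c := 1) (c₀ := 1) (s := 7) hE (hκ j) (by have := hκ j; positivity)
      (by linarith) zero_le_one le_rfl (by norm_num) hr₀pos hc7
    rw [hρ₀ j, show (Real.exp 2 * (κ j + κ j + (κ j + κ j + (κ j + κ j)) + κ j)) ^ 2 * (r₀ * κ j)⁻¹ ^ 2 =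
      (Real.exp 2 * (κ j + κ j + (κ j + κ j + (κ j + κ j)) + κ j)) ^ 2 * (1 ^ 2 * (r₀ * κ j)⁻¹ ^ 2) by ring]
    exact h.trans (by norm_num)
  -- §3 the majorants, chosen as the exact expressions of `towerSmallness_of_geom`, and their bounds
  obtain ⟨nb₀, hnb₀⟩ : ∃ nb₀ : ℕ → ℝ, ∀ j, nb₀ j = A j / (1 - (Real.exp 2 * (κ j + ρ₀ j)) ^ 2 * q j) := ⟨_, fun _ => rfl⟩
  have hnb₀eq : ∀ j, nb₀ j = 2 * A j := fun j => by rw [hnb₀, hqid j]; ring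
  obtain ⟨Db, hDb⟩ : ∃ Db : ℕ → ℝ, ∀ j, Db j = Real.exp 1 * nb₀ j / (1 - Real.exp 1 * aW j * nb₀ j / κ j ^ 2) := ⟨_, fun _ => rfl⟩
  obtain ⟨Bm, hBm⟩ : ∃ Bm : ℕ → ℝ, ∀ j, Bm j = if j = 0 then A 0 else Db (j - 1) := ⟨_, fun _ => rfl⟩
  have hBm0 : Bm 0 = A 0 := by rw [hBm]; simp
  have hBms : ∀ j, Bm (j + 1) = Db j := fun j => by rw [hBm]; simp
  obtain ⟨nb₃, hnb₃⟩ : ∃ nb₃ : ℕ → ℝ, ∀ j, nb₃ j = A j / (1 - (Real.exp 2 * (κ j + κ j)) ^ 2 * q j) := ⟨_, fun _ => rfl⟩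
  obtain ⟨nbS, hnbS⟩ : ∃ nbS : ℕ → ℝ, ∀ j, nbS j = cW j * Bm j / (1 - (Real.exp 2 * (κ j + κ j)) ^ 2 * (cW j ^ 2 * τ j)) := ⟨_, fun _ => rfl⟩
  obtain ⟨nbE, hnbE⟩ : ∃ nbE : ℕ → ℝ, ∀ j, nbE j = cW j * Bm j * (6 / (1 - (Real.exp 2 * (κ j + κ j)) ^ 2 * (cW j ^ 2 * τ j)) +
      14 * ((Real.exp 2 * (κ j + κ j)) ^ 2 * (cW j ^ 2 * τ j) / (1 - (Real.exp 2 * (κ j + κ j)) ^ 2 * (cW j ^ 2 * τ j)) ^ 2)) := ⟨_, fun _ => rfl⟩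
  obtain ⟨nb₇, hnb₇⟩ : ∃ nb₇ : ℕ → ℝ, ∀ j, nb₇ j = cW j * Bm j / (1 - (Real.exp 2 * (κf j + κ j)) ^ 2 * (cW j ^ 2 * τ j)) := ⟨_, fun _ => rfl⟩
  obtain ⟨nb₈, hnb₈⟩ : ∃ nb₈ : ℕ → ℝ, ∀ j, nb₈ j = 2 * Bm j * ((Real.exp 2 * (κf j + κ j)) ^ 2 * ((cW j + δb j) ^ 2 * τ j) /
      (1 - (Real.exp 2 * (κf j + κ j)) ^ 2 * ((cW j + δb j) ^ 2 * τ j)) ^ 2) := ⟨_, fun _ => rfl⟩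
  -- the own-scale weight dominates `2e·aW·A/κ²`
  have hW : ∀ j, j < J → Real.exp 1 * aW j * (2 * A j) / κ j ^ 2 ≤ 1 / 8 := by
    intro j hj
    have hk := hκ j
    rw [div_le_iff₀ (by positivity)]
    have ha : aW j ≤ aW j + cRb j + cCb j + 1 := by linarith [hcRb j, hcCb j]
    have hb : 16 ≤ 42 * cW j + 4 * δb j + 8 * Real.exp 1 := by nlinarith [hcW1 j, hδb0 j, he1]
    have h1 : Real.exp 1 * aW j * (2 * A j) * 8 = (Real.exp 1 * A j) * (aW j * 16) := by ring
    have h2 : (Real.exp 1 * A j) * (aW j * 16) ≤ (Real.exp 1 * A j) * ((aW j + cRb j + cCb j + 1) * (42 * cW j + 4 * δb j + 8 * Real.exp 1)) :=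
      mul_le_mul_of_nonneg_left (mul_le_mul ha hb (by norm_num) (by linarith [haW j, hcRb j, hcCb j])) (mul_nonneg he.le (hA0 j))
    have h3 := hS j hj
    nlinarith [h1, h2, h3]
  have hθ₀le : ∀ j, j < J → Real.exp 1 * aW j * nb₀ j / κ j ^ 2 ≤ 1 / 8 := fun j hj => by rw [hnb₀eq]; exact hW j hj
  -- the own-scale weight dominates `e²·aW·A` through the `8e` term
  have hW' : ∀ j, j < J → Real.exp 1 ^ 2 * aW j * A j ≤ κ j ^ 2 / 16 := by
    intro j hj
    have ha : aW j ≤ aW j + cRb j + cCb j + 1 := by linarith [hcRb j, hcCb j]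
    have hb : 8 * Real.exp 1 ≤ 42 * cW j + 4 * δb j + 8 * Real.exp 1 := by nlinarith [hcW1 j, hδb0 j]
    have h2 : (Real.exp 1 * A j) * (aW j * (8 * Real.exp 1)) ≤ (Real.exp 1 * A j) * ((aW j + cRb j + cCb j + 1) * (42 * cW j + 4 * δb j + 8 * Real.exp 1)) :=
      mul_le_mul_of_nonneg_left (mul_le_mul ha hb (by positivity) (by linarith [haW j, hcRb j, hcCb j])) (mul_nonneg he.le (hA0 j))
    have h3 := hS j hj
    nlinarith [h2, h3]
  have hDble : ∀ j, j < J → Db j ≤ 4 * Real.exp 1 * A j := fun j hj => by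
    rw [hDb]
    calc Real.exp 1 * nb₀ j / (1 - Real.exp 1 * aW j * nb₀ j / κ j ^ 2) ≤ 2 * (Real.exp 1 * nb₀ j) :=
          div_one_sub_le_two_mul (by rw [hnb₀eq]; have := hA0 j; positivity) ((hθ₀le j hj).trans (by norm_num))
      _ = 4 * Real.exp 1 * A j := by rw [hnb₀eq]; ring
  have hDb0 : ∀ j, j < J → 0 ≤ Db j := fun j hj => by
    rw [hDb]; exact div_one_sub_nonneg (by rw [hnb₀eq]; have := hA0 j; positivity) ((hθ₀le j hj).trans_lt (by norm_num))
  have hBm0le : ∀ j, j < J → 0 ≤ Bm j := fun j hj => by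
    cases j with
    | zero => rw [hBm0]; exact hA0 0
    | succ i => rw [hBms]; exact hDb0 i (by omega)
  -- the `Bm`-weight: `e (aW+cRb+cCb+1)(42 cW + 4 δb + 8e) Bm_j ≤ κ_j²/2`
  have hSB : ∀ j, j < J → Real.exp 1 * (aW j + cRb j + cCb j + 1) * (42 * cW j + 4 * δb j + 8 * Real.exp 1) * Bm j ≤ κ j ^ 2 / 2 := by
    intro j hj
    cases j with
    | zero => rw [hBm0]; exact hS 0 hj
    | succ i =>
      rw [hBms]
      have hpre : 0 ≤ Real.exp 1 * (aW (i + 1) + cRb (i + 1) + cCb (i + 1) + 1) * (42 * cW (i + 1) + 4 * δb (i + 1) + 8 * Real.exp 1) := by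
        have := haW (i + 1); have := hcRb (i + 1); have := hcCb (i + 1); have := hcW1 (i + 1); have := hδb0 (i + 1); positivity
      exact (mul_le_mul_of_nonneg_left (hDble i (by omega)) hpre).trans (hS' i hj)
  -- bounds of the majorants
  have hnb₃le : ∀ j, nb₃ j ≤ 2 * A j := fun j => by rw [hnb₃]; exact div_one_sub_le_two_mul (hA0 j) (hR1 j)
  have hnbSle : ∀ j, j < J → nbS j ≤ 2 * (cW j * Bm j) := fun j hj => by
    rw [hnbS]; exact div_one_sub_le_two_mul (mul_nonneg (zero_le_one.trans (hcW1 j)) (hBm0le j hj)) (hX1 j)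
  have hnbEle : ∀ j, j < J → nbE j ≤ 40 * (cW j * Bm j) := fun j hj => by
    rw [hnbE]
    have h6 : 6 / (1 - (Real.exp 2 * (κ j + κ j)) ^ 2 * (cW j ^ 2 * τ j)) ≤ 12 := (div_one_sub_le_two_mul (by norm_num) (hX1 j)).trans (by norm_num)
    have h14 : 14 * ((Real.exp 2 * (κ j + κ j)) ^ 2 * (cW j ^ 2 * τ j) / (1 - (Real.exp 2 * (κ j + κ j)) ^ 2 * (cW j ^ 2 * τ j)) ^ 2) ≤ 28 := by
      linarith [div_sq_one_sub_le_two (hX1 j)]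
    have hcb : 0 ≤ cW j * Bm j := mul_nonneg (zero_le_one.trans (hcW1 j)) (hBm0le j hj)
    nlinarith
  have hnb₇le : ∀ j, j < J → nb₇ j ≤ 2 * (cW j * Bm j) := fun j hj => by
    rw [hnb₇]; exact div_one_sub_le_two_mul (mul_nonneg (zero_le_one.trans (hcW1 j)) (hBm0le j hj)) (hY7 j)
  have hnb₈le : ∀ j, j < J → nb₈ j ≤ 4 * Bm j := fun j hj => by
    rw [hnb₈]
    have h := div_sq_one_sub_le_two (hY6 j)
    have hb := hBm0le j hj
    nlinarith
  have hnb₀0 : ∀ j, 0 ≤ nb₀ j := fun j => by rw [hnb₀eq]; have := hA0 j; positivity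
  have hnb₃0 : ∀ j, 0 ≤ nb₃ j := fun j => by rw [hnb₃]; exact div_one_sub_nonneg (hA0 j) ((hR1 j).trans_lt (by norm_num))
  -- §4 the five smallness lines
  have hθ₀ : ∀ j, j < J → Real.exp 1 * aW j * nb₀ j / κ j ^ 2 < 1 := fun j hj => (hθ₀le j hj).trans_lt (by norm_num)
  have hθw : ∀ j, j < J → Real.exp 1 * (aW j + aW j + (aW j + aW j)) * (Db j / (1 - (Real.exp 2 * (κ j + κ j + κ j)) ^ 2 * (ρ₀ j)⁻¹ ^ 2)) /
      (κ j + κ j) ^ 2 < 1 := by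
    intro j hj
    have hk := hκ j
    have hD : Db j / (1 - (Real.exp 2 * (κ j + κ j + κ j)) ^ 2 * (ρ₀ j)⁻¹ ^ 2) ≤ 2 * Db j := div_one_sub_le_two_mul (hDb0 j hj) (hR5 j)
    have h1 : Real.exp 1 * (aW j + aW j + (aW j + aW j)) * (Db j / (1 - (Real.exp 2 * (κ j + κ j + κ j)) ^ 2 * (ρ₀ j)⁻¹ ^ 2)) ≤
        Real.exp 1 * (4 * aW j) * (2 * (4 * Real.exp 1 * A j)) := by
      have := hDble j hj
      have h4 : Real.exp 1 * (aW j + aW j + (aW j + aW j)) = Real.exp 1 * (4 * aW j) := by ring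
      rw [h4]
      exact mul_le_mul_of_nonneg_left (hD.trans (by linarith)) (by have := haW j; positivity)
    rw [div_lt_one (by positivity)]
    have h2 : Real.exp 1 * (4 * aW j) * (2 * (4 * Real.exp 1 * A j)) = 32 * (Real.exp 1 ^ 2 * aW j * A j) := by ring
    nlinarith [h1, h2, hW' j hj, hk]
  have hθ₂ : ∀ j, j < J → Real.exp 1 * (aW j + aW j + (aW j + aW j)) *
      (Db j / (1 - (Real.exp 2 * (κ j + κ j + (κ j + κ j + (κ j + κ j)) + κ j)) ^ 2 * (ρ₀ j)⁻¹ ^ 2)) / (κ j + κ j + (κ j + κ j + (κ j + κ j))) ^ 2 < 1 := by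
    intro j hj
    have hk := hκ j
    have hD : Db j / (1 - (Real.exp 2 * (κ j + κ j + (κ j + κ j + (κ j + κ j)) + κ j)) ^ 2 * (ρ₀ j)⁻¹ ^ 2) ≤ 2 * Db j :=
      div_one_sub_le_two_mul (hDb0 j hj) (hR4 j)
    have h1 : Real.exp 1 * (aW j + aW j + (aW j + aW j)) *
        (Db j / (1 - (Real.exp 2 * (κ j + κ j + (κ j + κ j + (κ j + κ j)) + κ j)) ^ 2 * (ρ₀ j)⁻¹ ^ 2)) ≤ Real.exp 1 * (4 * aW j) * (2 * (4 * Real.exp 1 * A j)) := by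
      have := hDble j hj
      have h4 : Real.exp 1 * (aW j + aW j + (aW j + aW j)) = Real.exp 1 * (4 * aW j) := by ring
      rw [h4]
      exact mul_le_mul_of_nonneg_left (hD.trans (by linarith)) (by have := haW j; positivity)
    rw [div_lt_one (by positivity)]
    have h2 : Real.exp 1 * (4 * aW j) * (2 * (4 * Real.exp 1 * A j)) = 32 * (Real.exp 1 ^ 2 * aW j * A j) := by ring
    nlinarith [h1, h2, hW' j hj, hk]
  have hbar : ∀ j, j < J → Real.exp 1 * aW j * ((nb₃ j + (nbS j + nb₃ j)) + nbE j) / κ j ^ 2 < 1 := by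
    intro j hj
    have hk := hκ j
    have hsum : (nb₃ j + (nbS j + nb₃ j)) + nbE j ≤ 4 * A j + 42 * (cW j * Bm j) := by
      linarith [hnb₃le j, hnbSle j hj, hnbEle j hj]
    have h1 : Real.exp 1 * aW j * ((nb₃ j + (nbS j + nb₃ j)) + nbE j) ≤ Real.exp 1 * aW j * (4 * A j + 42 * (cW j * Bm j)) :=
      mul_le_mul_of_nonneg_left hsum (by have := haW j; positivity)
    -- `e aW 4A ≤ κ²/4` from `hW`; `e aW 42 cW Bm ≤ κ²/2` from `hSB`
    have hWj := hW j hj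
    rw [div_le_iff₀ (by positivity)] at hWj
    have hB : Real.exp 1 * aW j * (42 * (cW j * Bm j)) ≤ κ j ^ 2 / 2 := by
      refine le_trans ?_ (hSB j hj)
      have ha : aW j ≤ aW j + cRb j + cCb j + 1 := by linarith [hcRb j, hcCb j]
      have hb : 42 * cW j ≤ 42 * cW j + 4 * δb j + 8 * Real.exp 1 := by linarith [hδb0 j, he.le]
      have hcb : 0 ≤ cW j * Bm j := mul_nonneg (zero_le_one.trans (hcW1 j)) (hBm0le j hj)
      calc Real.exp 1 * aW j * (42 * (cW j * Bm j)) = Real.exp 1 * aW j * (42 * cW j) * Bm j := by ring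
        _ ≤ Real.exp 1 * (aW j + cRb j + cCb j + 1) * (42 * cW j + 4 * δb j + 8 * Real.exp 1) * Bm j := by
            have := hBm0le j hj
            have h2 : Real.exp 1 * aW j * (42 * cW j) ≤ Real.exp 1 * (aW j + cRb j + cCb j + 1) * (42 * cW j + 4 * δb j + 8 * Real.exp 1) := by
              have := haW j; have := hcW1 j
              calc Real.exp 1 * aW j * (42 * cW j) ≤ Real.exp 1 * (aW j + cRb j + cCb j + 1) * (42 * cW j) := by gcongr
                _ ≤ Real.exp 1 * (aW j + cRb j + cCb j + 1) * (42 * cW j + 4 * δb j + 8 * Real.exp 1) :=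
                    mul_le_mul_of_nonneg_left hb (by have := hcRb j; have := hcCb j; positivity)
            exact mul_le_mul_of_nonneg_right h2 this
    rw [div_lt_one (by positivity)]
    nlinarith [h1, hWj, hB, hk]
  have hθf : ∀ j, j < J → Real.exp 1 * (aW j + (cRb j + cCb j)) * (nb₇ j + δb j * nb₈ j) / κf j ^ 2 < 1 := by
    intro j hj
    have hk := hκ j
    have hkf := hκf0 j
    have hsum : nb₇ j + δb j * nb₈ j ≤ (2 * cW j + 4 * δb j) * Bm j := by
      have h8 := mul_le_mul_of_nonneg_left (hnb₈le j hj) (hδb0 j)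
      nlinarith [hnb₇le j hj, h8]
    have h1 : Real.exp 1 * (aW j + (cRb j + cCb j)) * (nb₇ j + δb j * nb₈ j) ≤ Real.exp 1 * (aW j + (cRb j + cCb j)) * ((2 * cW j + 4 * δb j) * Bm j) :=
      mul_le_mul_of_nonneg_left hsum (by have := haW j; have := hcRb j; have := hcCb j; positivity)
    have h2 : Real.exp 1 * (aW j + (cRb j + cCb j)) * ((2 * cW j + 4 * δb j) * Bm j) ≤
        Real.exp 1 * (aW j + cRb j + cCb j + 1) * (42 * cW j + 4 * δb j + 8 * Real.exp 1) * Bm j := by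
      have hb := hBm0le j hj
      have h3 : Real.exp 1 * (aW j + (cRb j + cCb j)) * (2 * cW j + 4 * δb j) ≤
          Real.exp 1 * (aW j + cRb j + cCb j + 1) * (42 * cW j + 4 * δb j + 8 * Real.exp 1) := by
        have := haW j; have := hcRb j; have := hcCb j; have := hcW1 j; have := hδb0 j
        have ha : aW j + (cRb j + cCb j) ≤ aW j + cRb j + cCb j + 1 := by linarith
        have hc : 2 * cW j + 4 * δb j ≤ 42 * cW j + 4 * δb j + 8 * Real.exp 1 := by linarith [he.le]
        calc Real.exp 1 * (aW j + (cRb j + cCb j)) * (2 * cW j + 4 * δb j) ≤ Real.exp 1 * (aW j + cRb j + cCb j + 1) * (2 * cW j + 4 * δb j) := by gcongr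
          _ ≤ Real.exp 1 * (aW j + cRb j + cCb j + 1) * (42 * cW j + 4 * δb j + 8 * Real.exp 1) := mul_le_mul_of_nonneg_left hc (by positivity)
      calc Real.exp 1 * (aW j + (cRb j + cCb j)) * ((2 * cW j + 4 * δb j) * Bm j) = Real.exp 1 * (aW j + (cRb j + cCb j)) * (2 * cW j + 4 * δb j) * Bm j := by ring
        _ ≤ _ := mul_le_mul_of_nonneg_right h3 hb
    have h4 : κ j ^ 2 ≤ κf j ^ 2 := pow_le_pow_left₀ hk.le (hκfge j) 2
    rw [div_lt_one (by positivity)]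
    nlinarith [h1, h2, hSB j hj, h4]
  -- §5 the generic theorem
  obtain ⟨NS, ν₀, ν₁, ν₂, ν₃, ν₄, ν₅, νE, ν₆, ν₇, ν₈, hNSnn, hNS0, hNSsucc, hsm⟩ :=
    towerSmallness_of_geom J κ κ aW aW cW κf cRb cCb δb ρ₀ κ κ κ κ A q Bm τ nb₀ Db nb₃ nbS nbE nb₇ nb₈ NV hκ haW haW hcW1 hcRb hcCb hδb0 hρ₀pos hq0 hτnn
      hNV0 hNV (by rw [hBm0]) hτ0le (fun j _ => by rw [hBms]) hτsucc hr₀' hr₅' hr₄' hr₁' hx₁' hy₆'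
      (fun j _ => by rw [hnb₀]) (fun j _ => by rw [hDb]) (fun j _ => by rw [hnb₃]) (fun j _ => by rw [hnbS]) (fun j _ => by rw [hnbE])
      (fun j _ => by rw [hnb₇]) (fun j _ => by rw [hnb₈]) hθ₀ hθw hθ₂ hbar hθf
  exact ⟨ρ₀, NS, ν₀, ν₁, ν₂, ν₃, ν₄, ν₅, νE, ν₆, ν₇, ν₈, hρ₀pos, hNSnn, hNS0, hNSsucc, hsm⟩

end Summit.HubbardSuperconductivity.HubbardSuperconductivity.Theorems.TwoVolumeSource

end
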